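import Mathlib
import HarnessLib
import Summits.AtomisticToContinuum.FouriersLaw.Theses.ThermostatLiouville

/-!
# Birth skeleton (BC3) for crux `ThermostatLiouville.LinearResponseTightness`
(item `stmt-AtomisticToContinuum-13700`, route `route-AtomisticToContinuum-ThermostatLiouville`, crux rank 3;
sub-problem `FouriersLaw`; registrar `planner-skel-stmt-AtomisticToContinuum-13700-0`, 2026-08-17)

Crux (FIXED, concluded BY NAME below): for `pinnedChain ω₂ lam β γ` (all `> 0`), under weak-NESS uniqueness,
along any steady-state family `μ`, for every `T > 0`, window length `n` and weight `m` there is `C` with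
`|d| ≤ C` for every `N`, every position `a` with `a + n + 2 ≤ N`, every temperate window observable `g`
with `|g z| ≤ (1+‖z‖)^m` and every derivative `d` at `δ = 0` of `δ ↦ ∫ g(sites a..a+n−1) dμ_(N, T+δ/2, T−δ/2)`
— N- AND POSITION-UNIFORM FIRST-ORDER RESPONSE BOUNDS.

## Line `birth` — KUBO–POISSON TRANSFER: the response is an EQUILIBRIUM pairing, bounded uniformly

The first-order response is moved onto the EQUAL-TEMPERATURE (equilibrium, Gibbs) steady state `μ N T T`:
differentiating the steady-state equation `∫ L_(T+δ/2, T−δ/2) F dμ^δ = 0` at `δ = 0`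
(`∂_δ L_δ = (γ/2)(∂²_{p_0} − ∂²_{p_{N−1}})`) and Gaussian integration by parts in the bath momenta under
the Gibbs state give, for every temperate `F` with `L_(T,T) F = g∘window − m₀`,
`d = c · ∫ (p_0² − p_{N−1}²) · F d(μ N T T)` with `c = −γ/(2T²)` (N-free).  So the crux is the conjunction of

* `stub_responseIdentity` (FIXED-N FIRST-ORDER RESPONSE IDENTITY on the range of the generator; size L,
  known-type: extension of the weak equation to temperate tests, weak continuity of `δ ↦ μ^δ` on temperate
  observables, `μ N T T` = Gibbs by uniqueness + `pinnedChain_isSteadyState_gibbsMeasure`, Gaussian IBP):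
  `∃ c` (parameters, `T`; NOT `N`) with `d = c · ∫ (p_0² − p_{N−1}²) F d(μ N T T)` whenever `F` is temperate,
  `L_(T,T) F = g∘window − m₀` pointwise and `d` is a derivative at `0` of `δ ↦ ∫ g∘window dμ^δ`.
  [HairerMajda2009 (fixed-N linear response of hypoelliptic diffusions), KunduDharNarayan2009 (open-chain
  Green–Kubo/response formula), ReyBellet2003 Rem 4.4, CuneoEckmannHairerReyBellet2018 Thm 2.13]
* `stub_poissonSolvable` (FIXED-N POISSON EQUATION IN THE TEMPERATE CLASS; size L, known-type up to the
  weight class): every temperate window observable read on `PhaseSpace N` (`N ≥ n + a + 2`) is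
  `L_(T,T) F + m₀` for some temperate `F` and constant `m₀` (hypoellipticity — EckmannPilletReyBellet1999a §3 —
  plus the CEHR2018 Lyapunov–spectral-gap theory; the polynomial (temperate) weight class instead of `e^{θH}`
  is the part not in print: Hairer–Mattingly 2009 polynomial-weight techniques).
* `stub_uniformBoundaryPairing` (THE N-UNIFORM CONTENT, hardest, XL): for every `n, m` there is `C`
  (NOT depending on `N`, `a`) with `|∫ (p_0² − p_{N−1}²) F d(μ N T T)| ≤ C` for every temperate solution `F`
  of `L_(T,T) F = g∘window − m₀`, `g` temperate of weight `m`.  An EQUILIBRIUM space–time statement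
  (`F = −∫₀^∞ P_t(g∘window − ⟨g⟩) dt` formally; the pairing is `−∫₀^∞ Cov_Gibbs(p_0² − p_{N−1}², P_t g) dt`):
  why easier — detailed balance up to momentum flip is available, `p_0² + p_{N−1}² − 2T = −γ⁻¹ L^*H` turns
  the symmetric half into the STATIC covariance `−γ⁻¹ Cov_Gibbs(H_N, g∘window)` (bounded uniformly by 1-D
  decay of Gibbs correlations, BrascampLieb1976), and a linearly weighted energy `W = Σ wᵢ eᵢ` turns the
  antisymmetric half into a static covariance plus the `1/(N−1)`-NORMALISED current pairing
  `(2/(γ(N−1))) ∫ J_tot · F dGibbs` — bounded iff time-integrated total-current/local-observable equilibrium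
  correlations are `O(N)`, true for ballistic (harmonic, RiederLebowitzLieb1967) and diffusive chains alike:
  no transport content, only compactness, exactly as the item text says.
* COMPOSITION (sorry-free): `linearResponseTightness_of_stubs` — given `d`, take `F, m₀` from
  `stub_poissonSolvable`, rewrite `d = c · pairing` by `stub_responseIdentity`, bound by
  `stub_uniformBoundaryPairing`: `|d| = |c|·|pairing| ≤ |c|·C`.  `LinearResponseTightness_of` is that term at the
  crux's NAME with the three stubs plugged in (the only theorem here concluding the crux; its sorries are
  exactly the three stubs').

Why the cut is not a costume: `stub_responseIdentity` is an identity with no bound, `stub_poissonSolvable` an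
existence statement with no bound, `stub_uniformBoundaryPairing` bounds an equilibrium pairing that is not a
derivative of anything — none is the crux reworded, and the BC3 probes `stub → LinearResponseTightness`,
`stub → FouriersLaw` by `first | exact? | simpa | aesop` FAIL for all three (planner folder `bc/`, quoted in
`Lines/birth.md`).  Degenerate corners: `N ≤ 1` never occurs (`a + n + 2 ≤ N`), so the two bath momenta
`p_0`, `p_{N−1}` are distinct sites; the refuter's `n = 0` corner (Degenerate.lean: empty window, `C = 0`) is
consistent with all three stubs (constant `g`: `F` constant, pairing `0`).
Disproof used: none on file (`ledger crux ls stmt-AtomisticToContinuum-13700`: no workfiles, no `Disproof.lean`,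
no `Negative/` lemma, 2026-08-17); negatives index: no FouriersLaw entry touching this crux.
-/

noncomputable section

namespace Summit.AtomisticToContinuum.FouriersLaw.Cruxes.LinearResponseTightness

namespace Birth

open MeasureTheory

/-! ## The three registered stubs -/

/-- **stub 1 — `stub_responseIdentity` (fixed-N first-order response identity on the range of the
generator).**  For `pinnedChain ω₂ lam β γ` (all `> 0`), under weak-NESS uniqueness, for `T > 0` and any
steady-state family `μ` there is `c : ℝ` (expected value `−γ/(2T²)`; independent of `N`) such that: whenever
`g` (on `n` sites) and `F` (on `N ≥ a+n+2` sites) are temperate, `L_(T,T) F = g∘window_a − m₀` pointwise, and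
`d` is a derivative at `δ = 0` of `δ ↦ ∫ g∘window_a dμ_(N,T+δ/2,T−δ/2)`, then
`d = c · ∫ (p_0² − p_(N−1)²)·F d(μ N T T)`.  (Differentiate `∫ L_δ F dμ^δ = 0` at `δ = 0`;
`∂_δ L_δ = (γ/2)(∂²_(p_0) − ∂²_(p_(N−1)))`; `μ N T T` is the Gibbs state; Gaussian IBP
`∫ ∂²_p F dGibbs = T⁻² ∫ (p² − T) F dGibbs`.)  Size L, known-type at fixed `N`. -/
theorem stub_responseIdentity :
    ∀ ω₂ lam β γ : ℝ, 0 < ω₂ → 0 < lam → 0 < β → 0 < γ → (∀ (N : ℕ) (T_L T_R : ℝ), 0 < T_L → 0 < T_R → ∀ μ ν : MeasureTheory.Measure (Literature.MathematicalPhysics.KineticTheory.HeatConduction.PhaseSpace N), (Literature.MathematicalPhysics.KineticTheory.HeatConduction.pinnedChain ω₂ lam β γ).IsSteadyState N T_L T_R μ → (Literature.MathematicalPhysics.KineticTheory.HeatConduction.pinnedChain ω₂ lam β γ).IsSteadyState N T_L T_R ν → μ = ν) → ∀ T : ℝ, 0 < T → ∀ μ : (N : ℕ) → ℝ → ℝ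 → MeasureTheory.Measure (Literature.MathematicalPhysics.KineticTheory.HeatConduction.PhaseSpace N), (∀ (N : ℕ) (T_L T_R : ℝ), 0 < T_L → 0 < T_R → (Literature.MathematicalPhysics.KineticTheory.HeatConduction.pinnedChain ω₂ lam β γ).IsSteadyState N T_L T_R (μ N T_L T_R)) → ∃ c : ℝ, ∀ (n N a : ℕ) (h : a + n + 2 ≤ N) (g : Literature.MathematicalPhysics.KineticTheory.HeatConduction.PhaseSpace n → ℝ) (F : Literature.MathematicalPhysics.KineticTheory.HeatConduction.PhaseSpace N → ℝ) (m₀ d : ℝ), g.HasTemperateGrowth → F.HasTemperateGrowth → (∀ x, (Literature.MathematicalPhysics.KineticTheory.HeatConduction.pinnedChain ω₂ lam β γ).generator N T T F x = g (fun i => x.1 (Fin.castLE ((Nat.le_add_right (a + n) 2).trans h) (Fin.natAdd a i)), fun i => x.2 (Fin.castLE ((Nat.le_add_right (a + n) 2).trans h) (Fin.natAdd a i))) - m₀) → HasDerivAt (fun δ : ℝ => ∫ x, g (fun i => x.1 (Fin.castLE ((Nat.le_add_right (a + n) 2).trans h) (Fin.natAdd a i)), fun i => x.2 (Fin.castLE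 ((Nat.le_add_right (a + n) 2).trans h) (Fin.natAdd a i))) ∂(μ N (T + δ / 2) (T - δ / 2))) d 0 → d = c * ∫ x, ((x.2 ⟨0, by omega⟩) ^ 2 - (x.2 ⟨N - 1, by omega⟩) ^ 2) * F x ∂(μ N T T) := by
  sorry

/-- **stub 2 — `stub_poissonSolvable` (fixed-N Poisson equation for the equal-temperature generator in the
temperate class).**  For `pinnedChain ω₂ lam β γ` (all `> 0`), `T > 0`, `N ≥ a + n + 2` and every temperate
`g` on `n` sites there are a temperate `F : PhaseSpace N → ℝ` and a constant `m₀` with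
`L_(T,T) F = g∘window_a − m₀` pointwise (`m₀` is then the Gibbs mean of `g∘window_a`; formally
`F = −∫₀^∞ P_t (g∘window_a − m₀) dt`).  Hypoelliptic regularity + Lyapunov–spectral-gap theory at fixed `N`;
the temperate (polynomial) weight class is the delicate part.  Size L. -/
theorem stub_poissonSolvable :
    ∀ ω₂ lam β γ : ℝ, 0 < ω₂ → 0 < lam → 0 < β → 0 < γ → ∀ T : ℝ, 0 < T → ∀ (n N a : ℕ) (h : a + n + 2 ≤ N) (g : Literature.MathematicalPhysics.KineticTheory.HeatConduction.PhaseSpace n → ℝ), g.HasTemperateGrowth → ∃ (F : Literature.MathematicalPhysics.KineticTheory.HeatConduction.PhaseSpace N → ℝ) (m₀ : ℝ), F.HasTemperateGrowth ∧ (∀ x, (Literature.MathematicalPhysics.KineticTheory.HeatConduction.pinnedChain ω₂ lam β γ).generator N T T F x = g (fun i => x.1 (Fin.castLE ((Nat.le_add_right (a + n) 2).trans h) (Fin.natAdd a i)), fun i => x.2 (Fin.castLE ((Nat.le_add_right (a + n) 2).trans h) (Fin.natAdd a i))) - m₀) := by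
  sorry

/-- **stub 3 — `stub_uniformBoundaryPairing` (THE N-UNIFORM CONTENT: equilibrium boundary pairing of Poisson
solutions is bounded uniformly in `N` and in the window position).**  For `pinnedChain ω₂ lam β γ`
(all `> 0`), under weak-NESS uniqueness, for `T > 0`, any steady-state family `μ` and every `n, m` there is
`C` such that for all `N`, `a` with `a + n + 2 ≤ N`, every temperate `g` on `n` sites with `|g z| ≤ (1+‖z‖)^m`
and EVERY temperate `F` on `N` sites with `L_(T,T) F = g∘window_a − m₀`:
`|∫ (p_0² − p_(N−1)²)·F d(μ N T T)| ≤ C`  (`μ N T T` = the Gibbs state at `T`).  Size XL (hardest stub). -/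
theorem stub_uniformBoundaryPairing :
    ∀ ω₂ lam β γ : ℝ, 0 < ω₂ → 0 < lam → 0 < β → 0 < γ → (∀ (N : ℕ) (T_L T_R : ℝ), 0 < T_L → 0 < T_R → ∀ μ ν : MeasureTheory.Measure (Literature.MathematicalPhysics.KineticTheory.HeatConduction.PhaseSpace N), (Literature.MathematicalPhysics.KineticTheory.HeatConduction.pinnedChain ω₂ lam β γ).IsSteadyState N T_L T_R μ → (Literature.MathematicalPhysics.KineticTheory.HeatConduction.pinnedChain ω₂ lam β γ).IsSteadyState N T_L T_R ν → μ = ν) → ∀ T : ℝ, 0 < T → ∀ μ : (N : ℕ) → ℝ → ℝ → MeasureTheory.Measure (Literature.MathematicalPhysics.KineticTheory.HeatConduction.PhaseSpace N), (∀ (N : ℕ) (T_L T_R : ℝ), 0 < T_L → 0 < T_R → (Literature.MathematicalPhysics.KineticTheory.HeatConduction.pinnedChain ω₂ lam β γ).IsSteadyState N T_L T_R (μ N T_L T_R)) → ∀ n m : ℕ, ∃ C : ℝ, ∀ (N a : ℕ) (h : a + n + 2 ≤ N) (g : Literature.MathematicalPhysics.KineticTheory.HeatConduction.PhaseSpace n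 → ℝ) (F : Literature.MathematicalPhysics.KineticTheory.HeatConduction.PhaseSpace N → ℝ) (m₀ : ℝ), g.HasTemperateGrowth → (∀ z, |g z| ≤ (1 + ‖z‖) ^ m) → F.HasTemperateGrowth → (∀ x, (Literature.MathematicalPhysics.KineticTheory.HeatConduction.pinnedChain ω₂ lam β γ).generator N T T F x = g (fun i => x.1 (Fin.castLE ((Nat.le_add_right (a + n) 2).trans h) (Fin.natAdd a i)), fun i => x.2 (Fin.castLE ((Nat.le_add_right (a + n) 2).trans h) (Fin.natAdd a i))) - m₀) → |∫ x, ((x.2 ⟨0, by omega⟩) ^ 2 - (x.2 ⟨N - 1, by omega⟩) ^ 2) * F x ∂(μ N T T)| ≤ C := by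
  sorry

/-! ## The composition (sorry-free) -/

/-- **The implication, sorry-free**: `stub_responseIdentity`-statement → `stub_poissonSolvable`-statement →
`stub_uniformBoundaryPairing`-statement → the statement of `ThermostatLiouville.LinearResponseTightness`
(conclusion = the crux's definiens VERBATIM, so that `LinearResponseTightness_of` below is this term at the
crux's name), with `C := |c| · C₃`. -/
theorem linearResponseTightness_of_stubs :
    (∀ ω₂ lam β γ : ℝ, 0 < ω₂ → 0 < lam → 0 < β → 0 < γ → (∀ (N : ℕ) (T_L T_R : ℝ), 0 < T_L → 0 < T_R → ∀ μ ν : MeasureTheory.Measure (Literature.MathematicalPhysics.KineticTheory.HeatConduction.PhaseSpace N), (Literature.MathematicalPhysics.KineticTheory.HeatConduction.pinnedChain ω₂ lam β γ).IsSteadyState N T_L T_R μ → (Literature.MathematicalPhysics.KineticTheory.HeatConduction.pinnedChain ω₂ lam β γ).IsSteadyState N T_L T_R ν → μ = ν) → ∀ T : ℝ, 0 < T → ∀ μ : (N : ℕ) → ℝ → ℝ → MeasureTheory.Measure (Literature.MathematicalPhysics.KineticTheory.HeatConduction.PhaseSpace N), (∀ (N : ℕ) (T_L T_R : ℝ), 0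 < T_L → 0 < T_R → (Literature.MathematicalPhysics.KineticTheory.HeatConduction.pinnedChain ω₂ lam β γ).IsSteadyState N T_L T_R (μ N T_L T_R)) → ∃ c : ℝ, ∀ (n N a : ℕ) (h : a + n + 2 ≤ N) (g : Literature.MathematicalPhysics.KineticTheory.HeatConduction.PhaseSpace n → ℝ) (F : Literature.MathematicalPhysics.KineticTheory.HeatConduction.PhaseSpace N → ℝ) (m₀ d : ℝ), g.HasTemperateGrowth → F.HasTemperateGrowth → (∀ x, (Literature.MathematicalPhysics.KineticTheory.HeatConduction.pinnedChain ω₂ lam β γ).generator N T T F x = g (fun i => x.1 (Fin.castLE ((Nat.le_add_right (a + n) 2).trans h) (Fin.natAdd a i)), fun i => x.2 (Fin.castLE ((Nat.le_add_right (a + n) 2).trans h) (Fin.natAdd a i))) - m₀) → HasDerivAt (fun δ : ℝ => ∫ x, g (fun i => x.1 (Fin.castLE ((Nat.le_add_right (a + n) 2).trans h) (Fin.natAdd a i)), fun i => x.2 (Fin.castLE ((Nat.le_add_right (a + n) 2).trans h) (Fin.natAdd a i))) ∂(μ N (T + δ / 2) (T - δ / 2))) d 0 → d = c * ∫ x, ((x.2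 ⟨0, by omega⟩) ^ 2 - (x.2 ⟨N - 1, by omega⟩) ^ 2) * F x ∂(μ N T T)) →
    (∀ ω₂ lam β γ : ℝ, 0 < ω₂ → 0 < lam → 0 < β → 0 < γ → ∀ T : ℝ, 0 < T → ∀ (n N a : ℕ) (h : a + n + 2 ≤ N) (g : Literature.MathematicalPhysics.KineticTheory.HeatConduction.PhaseSpace n → ℝ), g.HasTemperateGrowth → ∃ (F : Literature.MathematicalPhysics.KineticTheory.HeatConduction.PhaseSpace N → ℝ) (m₀ : ℝ), F.HasTemperateGrowth ∧ (∀ x, (Literature.MathematicalPhysics.KineticTheory.HeatConduction.pinnedChain ω₂ lam β γ).generator N T T F x = g (fun i => x.1 (Fin.castLE ((Nat.le_add_right (a + n) 2).trans h) (Fin.natAdd a i)), fun i => x.2 (Fin.castLE ((Nat.le_add_right (a + n) 2).trans h) (Fin.natAdd a i))) - m₀)) →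
    (∀ ω₂ lam β γ : ℝ, 0 < ω₂ → 0 < lam → 0 < β → 0 < γ → (∀ (N : ℕ) (T_L T_R : ℝ), 0 < T_L → 0 < T_R → ∀ μ ν : MeasureTheory.Measure (Literature.MathematicalPhysics.KineticTheory.HeatConduction.PhaseSpace N), (Literature.MathematicalPhysics.KineticTheory.HeatConduction.pinnedChain ω₂ lam β γ).IsSteadyState N T_L T_R μ → (Literature.MathematicalPhysics.KineticTheory.HeatConduction.pinnedChain ω₂ lam β γ).IsSteadyState N T_L T_R ν → μ = ν) → ∀ T : ℝ, 0 < T → ∀ μ : (N : ℕ) → ℝ → ℝ → MeasureTheory.Measure (Literature.MathematicalPhysics.KineticTheory.HeatConduction.PhaseSpace N), (∀ (N : ℕ) (T_L T_R : ℝ), 0 < T_L → 0 < T_R → (Literature.MathematicalPhysics.KineticTheory.HeatConduction.pinnedChain ω₂ lam β γ).IsSteadyState N T_L T_R (μ N T_L T_R)) → ∀ n m : ℕ, ∃ C : ℝ, ∀ (N a : ℕ) (h : a + n + 2 ≤ N) (g : Literature.MathematicalPhysics.KineticTheory.HeatConduction.PhaseSpace n → ℝ) (F : Literature.MathematicalPhysics.KineticTheory.HeatConduction.PhaseSpace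 N → ℝ) (m₀ : ℝ), g.HasTemperateGrowth → (∀ z, |g z| ≤ (1 + ‖z‖) ^ m) → F.HasTemperateGrowth → (∀ x, (Literature.MathematicalPhysics.KineticTheory.HeatConduction.pinnedChain ω₂ lam β γ).generator N T T F x = g (fun i => x.1 (Fin.castLE ((Nat.le_add_right (a + n) 2).trans h) (Fin.natAdd a i)), fun i => x.2 (Fin.castLE ((Nat.le_add_right (a + n) 2).trans h) (Fin.natAdd a i))) - m₀) → |∫ x, ((x.2 ⟨0, by omega⟩) ^ 2 - (x.2 ⟨N - 1, by omega⟩) ^ 2) * F x ∂(μ N T T)| ≤ C) →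
    (∀ ω₂ lam β γ : ℝ, 0 < ω₂ → 0 < lam → 0 < β → 0 < γ → (∀ (N : ℕ) (T_L T_R : ℝ), 0 < T_L → 0 < T_R → ∀ μ ν : MeasureTheory.Measure (Literature.MathematicalPhysics.KineticTheory.HeatConduction.PhaseSpace N), (Literature.MathematicalPhysics.KineticTheory.HeatConduction.pinnedChain ω₂ lam β γ).IsSteadyState N T_L T_R μ → (Literature.MathematicalPhysics.KineticTheory.HeatConduction.pinnedChain ω₂ lam β γ).IsSteadyState N T_L T_R ν → μ = ν) → ∀ T : ℝ, 0 < T → ∀ μ : (N : ℕ) → ℝ → ℝ → MeasureTheory.Measure (Literature.MathematicalPhysics.KineticTheory.HeatConduction.PhaseSpace N), (∀ (N : ℕ) (T_L T_R : ℝ), 0 < T_L → 0 < T_R → (Literature.MathematicalPhysics.KineticTheory.HeatConduction.pinnedChain ω₂ lam β γ).IsSteadyState N T_L T_R (μ N T_L T_R)) → ∀ n m : ℕ, ∃ C : ℝ, ∀ (N a : ℕ) (h : a + n + 2 ≤ N) (g : Literature.MathematicalPhysics.KineticTheory.HeatConduction.PhaseSpace n → ℝ), g.HasTemperateGrowth →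 (∀ z, |g z| ≤ (1 + ‖z‖) ^ m) → ∀ d : ℝ, HasDerivAt (fun δ : ℝ => ∫ x, g (fun i => x.1 (Fin.castLE ((Nat.le_add_right (a + n) 2).trans h) (Fin.natAdd a i)), fun i => x.2 (Fin.castLE ((Nat.le_add_right (a + n) 2).trans h) (Fin.natAdd a i))) ∂(μ N (T + δ / 2) (T - δ / 2))) d 0 → |d| ≤ C) := by
  intro hA hB hC ω₂ lam β γ hω hl hβ hγ hU T hT μ hμ n m
  obtain ⟨c, hc⟩ := hA ω₂ lam β γ hω hl hβ hγ hU T hT μ hμ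
  obtain ⟨C, hCb⟩ := hC ω₂ lam β γ hω hl hβ hγ hU T hT μ hμ n m
  refine ⟨|c| * C, ?_⟩
  intro N a h g hg hgm d hd
  obtain ⟨F, m₀, hF, hLF⟩ := hB ω₂ lam β γ hω hl hβ hγ T hT n N a h g hg
  have hd' : d = c * _ := hc n N a h g F m₀ d hg hF hLF hd
  have hb := hCb N a h g F m₀ hg hgm hF hLF
  rw [hd', abs_mul]
  exact mul_le_mul_of_nonneg_left hb (abs_nonneg c)

/-- **Skeleton theorem — the crux `ThermostatLiouville.LinearResponseTightness` BY NAME from the three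
registered stubs** (the only theorem of this file concluding the crux; its `sorry`s are exactly those of
`stub_responseIdentity`, `stub_poissonSolvable`, `stub_uniformBoundaryPairing`; the seam is the sorry-free
`linearResponseTightness_of_stubs`). -/
theorem LinearResponseTightness_of :
    _root_.Summit.AtomisticToContinuum.FouriersLaw.Theses.ThermostatLiouville.LinearResponseTightness :=
  linearResponseTightness_of_stubs stub_responseIdentity stub_poissonSolvable stub_uniformBoundaryPairing

end Birth

end Summit.AtomisticToContinuum.FouriersLaw.Cruxes.LinearResponseTightness

end
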